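import Summits.KontsevichZagierPeriods.KontsevichZagierPeriods.Theorems.SoloBlindEllipticRegions
import Summits.KontsevichZagierPeriods.KontsevichZagierPeriods.Theorems.SoloBlindLemniscateSector
import Summits.KontsevichZagierPeriods.KontsevichZagierPeriods.Theorems.SoloBlindEquianharmonic
import HarnessLib

/-!
# The Fermat quartic in the lemniscate sector, `y² = 1 - x³` in the equianharmonic sector

Placing the two rational regions of `SoloBlindEllipticRegions` in the two unconditional rank-two
sectors:

* `[R₄] = (½·√2)•[A₂]` (`mkQ_quart2_eq_smul_lemnA2`), so `R₄ ∈ M([A₂],[B₂])`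
  (`of_quart2_mem_lemniscateSector`) and the Kontsevich–Zagier conjecture holds unconditionally
  for `R₄` against every representation of the lemniscate sector; explicitly
  `R₄ × B₂ ≡ ⅛·R_{1,4}` (`kz_quartic_lemniscate`: `∫∫_{x⁴+y⁴≤1} · ∫₀¹ x²dx/√(1-x⁴) = √2π/8`).
  On the way: Legendre's duplication constant at `¼` equals Euler's reflection constant at `¼`
  (`duplCoeff_quarter_eq_reflCoeff`, both `√2`).
* `2^{1/3}•[R₃] = (1/5)•u` (`smul_mkQ_ecub2`), so `R₃ ∈ M(u,v)` (`of_ecub2_mem_equiSector`);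
  explicitly `10·2^{1/3} · (R₃ × F_B) ≡ R_{1,3}` (`kz_ecub_fermat_reflection`:
  `10·2^{1/3} ∫∫_{y²≤1-x³} · ∫∫_{F_B} = 2π/√3`).

References: M. Kontsevich, D. Zagier, *Periods* (2001), §1.2; G. V. Chudnovsky (1984).
-/

noncomputable section

namespace Summit.KontsevichZagierPeriods.KontsevichZagierPeriods.Theorems

open Set MeasureTheory
open Literature.NumberTheory.Transcendental
open Literature.NumberTheory.Transcendental.KZ

namespace SoloBlind

/-! ## `R₄` in the lemniscate sector -/

/-- **Legendre's duplication constant at `¼` is Euler's reflection constant at `¼`** (`= √2`). -/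
theorem duplCoeff_quarter_eq_reflCoeff : duplCoeff (1 / 4) = reflCoeff 1 4 :=
  Subtype.ext (by rw [coe_duplCoeff_quarter, coe_reflCoeff_one_four])

/-- **`[R₄] = (½·duplCoeff ¼)•[A₂]`** in `Q`. -/
theorem mkQ_quart2_eq_smul_lemnA2 :
    mkQ (of quart2) = ((((1:ℚ) / 2 : ℚ) : K₀) * duplCoeff (1 / 4)) • mkQ (of lemnA2) := by
  rw [mkQ_quart2', mkQ_lemnA2, smul_smul]
  congr 1
  rw [mul_right_comm, ← Rat.cast_mul]
  norm_num

/-- **`R₄` lies in the lemniscate sector `M([A₂],[B₂])`.** -/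
theorem of_quart2_mem_lemniscateSector : of quart2 ∈ lemniscateSector := by
  rw [mem_lemniscateSector, mkQ_quart2_eq_smul_lemnA2]
  exact Subalgebra.smul_mem _ (Algebra.subset_adjoin (mem_range_self (f := lemnGen) 0)) _

/-- The Kontsevich–Zagier conjecture for `R₄` against the lemniscate sector, unconditionally. -/
theorem kz_quart2 {m : ℕ} (r' : IntegralRep m) (hr' : of r' ∈ lemniscateSector)
    (hv : quart2.value = r'.value) : Equivalent quart2 r' :=
  kz_lemniscateSector _ _ of_quart2_mem_lemniscateSector hr' hv

/-- **`R₄ ≡ (√2/2)·A₂`**: the Fermat quartic quadrant and the scaled lemniscatic arc-length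
representation have the same class (`h`: any proof that `√2/2` is algebraic, e.g. read off
`duplCoeff ¼ = √2 ∈ K₀`). -/
theorem kz_quart2_lemnA2 (h : IsAlgebraic ℚ (Real.sqrt 2 / 2)) :
    Equivalent quart2 (lemnA2.constMul (Real.sqrt 2 / 2) h) := by
  rw [Equivalent, ← mkQ_eq_mkQ_iff, mkQ_constMul, mkQ_quart2_eq_smul_lemnA2]
  congr 1
  apply Subtype.ext
  rw [MulMemClass.coe_mul, coe_ratCast_K₀, coe_duplCoeff_quarter]
  push_cast
  ring

/-- **`[R₄]·[B₂] = (⅛·√2)•x_π`** in `Q`. -/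
theorem quart_euler : mkQ (of quart2) * mkQ (of lemnB2) =
    ((((1:ℚ) / 8 : ℚ) : K₀) * reflCoeff 1 4) • xPi := by
  have hx : xPi = (4 : K₀) • alpha 1 := rfl
  rw [mkQ_quart2_eq_smul_lemnA2, Algebra.smul_mul_assoc, lemniscate_euler,
    duplCoeff_quarter_eq_reflCoeff, hx, smul_smul]
  congr 1
  have h4 : (4 : K₀) = ((4:ℚ) : K₀) := by norm_cast
  rw [h4, mul_right_comm, ← Rat.cast_mul]
  norm_num

/-- **`R₄ × B₂ ≡ ⅛·R_{1,4}`**: `∫∫_{x⁴+y⁴≤1} 1 · ∫₀¹ x²dx/√(1-x⁴)` and `⅛ ∫₀^∞ dv/(1+v⁴)`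
(both `ℚ`-rational, value `√2π/8`) are KZ-equivalent, by explicit moves. -/
theorem kz_quartic_lemniscate :
    Equivalent (quart2.prod lemnB2)
      ((reflRep 1 4 one_pos (by norm_num)).constMul (((1:ℚ) / 8 : ℚ) : ℝ)
        (isAlgebraic_rat ℚ _)) := by
  rw [Equivalent, ← mkQ_eq_mkQ_iff, ← of_mul_of, mkQ_mul, quart_euler, mkQ_constMul_ratCast,
    mkQ_reflRep, smul_smul]

/-- `area(R₄) · b = √2π/8`. -/
theorem quart2_value_mul_lemnB2_value :
    quart2.value * lemnB2.value = Real.sqrt 2 * Real.pi / 8 := by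
  have h := congrArg evalQ quart_euler
  rw [map_mul, evalQ_mkQ, evalQ_mkQ, eval_of, eval_of, evalQ_smul, evalQ_xPi,
    MulMemClass.coe_mul, coe_reflCoeff_one_four, coe_ratCast_K₀] at h
  rw [h]
  push_cast
  ring

/-- `area(R₄) = (√2/2)·a`, `a = ∫₀¹ dx/√(1-x⁴)`. -/
theorem quart2_value_eq : quart2.value = Real.sqrt 2 / 2 * lemnA2.value := by
  have h := congrArg evalQ mkQ_quart2_eq_smul_lemnA2
  rw [evalQ_mkQ, eval_of, evalQ_smul, evalQ_mkQ, eval_of, MulMemClass.coe_mul, coe_ratCast_K₀,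
    coe_duplCoeff_quarter] at h
  rw [h]
  push_cast
  ring

/-! ## `R₃` in the equianharmonic sector -/

/-- **`duplCoeff ⅓ • [R₃] = (1/5)•u`**, `u = β(⅓,⅓)`, `duplCoeff ⅓ = 2^{1/3}`. -/
theorem smul_mkQ_ecub2 :
    duplCoeff (1 / 3) • mkQ (of ecub2) = (((1:ℚ) / 5 : ℚ) : K₀) • betaQ (1 / 3) (1 / 3) := by
  rw [mkQ_ecub2, smul_smul, mul_comm, ← smul_smul, ← betaQ_dupl_third]

/-- **`R₃` lies in the equianharmonic sector `M(u,v)`.** -/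
theorem of_ecub2_mem_equiSector : of ecub2 ∈ equiSector := by
  rw [mem_equiSector, mkQ_ecub2']
  exact Subalgebra.smul_mem _ (Algebra.subset_adjoin (mem_range_self (f := equiGen) 0)) _

/-- The Kontsevich–Zagier conjecture for `R₃` against the equianharmonic sector. -/
theorem kz_ecub2 {m : ℕ} (r' : IntegralRep m) (hr' : of r' ∈ equiSector)
    (hv : ecub2.value = r'.value) : Equivalent ecub2 r' :=
  kz_equiSector _ _ of_ecub2_mem_equiSector hr' hv

/-- **`(10·2^{1/3}) • [R₃]·[F_B] = (1/sin(π/3)) • x_π`** in `Q`. -/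
theorem ecub_fermatB : ((10 : K₀) * duplCoeff (1 / 3)) • (mkQ (of ecub2) * mkQ (of fermatB2)) =
    reflCoeff 1 3 • xPi := by
  rw [← smul_smul, ← Algebra.smul_mul_assoc, smul_mkQ_ecub2, mkQ_fermatB2,
    Algebra.smul_mul_assoc, Algebra.mul_smul_comm, equi_relation]
  simp only [smul_smul]
  congr 1
  rw [equiCoeff]
  push_cast
  ring

/-- `10·2^{1/3}` is algebraic. -/
theorem isAlgebraic_ten_mul_cbrt_two : IsAlgebraic ℚ ((10:ℝ) * (2:ℝ) ^ ((1:ℝ) / 3)) := by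
  rw [← coe_duplCoeff_third]
  exact (by simpa using isAlgebraic_nat (R := ℚ) (A := ℝ) 10 : IsAlgebraic ℚ (10:ℝ)).mul
    (K₀.isAlgebraic _)

/-- **`10·2^{1/3}·(R₃ × F_B) ≡ R_{1,3}`**: `10·2^{1/3} ∫∫_{y²≤1-x³} 1 · ∫∫_{F_B} 1` and
`∫₀^∞ dv/(1+v³)` (value `2π/√3`) are KZ-equivalent, by explicit moves. -/
theorem kz_ecub_fermat_reflection :
    Equivalent ((ecub2.prod fermatB2).constMul ((10:ℝ) * (2:ℝ) ^ ((1:ℝ) / 3))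
      isAlgebraic_ten_mul_cbrt_two) (reflRep 1 3 one_pos (by norm_num)) := by
  rw [Equivalent, ← mkQ_eq_mkQ_iff, mkQ_constMul, ← of_mul_of, mkQ_mul, mkQ_reflRep,
    ← ecub_fermatB]
  congr 1
  apply Subtype.ext
  have h10 : ((10 : K₀) : ℝ) = 10 := rfl
  rw [MulMemClass.coe_mul, coe_duplCoeff_third, h10]

/-- `10·2^{1/3} · area(R₃) · area(F_B) = 2π/√3`. -/
theorem ecub2_value_mul_fermatB2_value :
    10 * (2:ℝ) ^ ((1:ℝ) / 3) * (ecub2.value * fermatB2.value) =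
      Real.pi / Real.sin (Real.pi * ((1:ℝ) / 3)) := by
  have h := congrArg evalQ ecub_fermatB
  have h10 : ((10 : K₀) : ℝ) = 10 := rfl
  rw [evalQ_smul, map_mul, evalQ_mkQ, evalQ_mkQ, eval_of, eval_of, evalQ_smul, evalQ_xPi,
    MulMemClass.coe_mul, coe_duplCoeff_third, h10, coe_reflCoeff] at h
  rw [h, Nat.cast_one, Nat.cast_ofNat, inv_mul_eq_div]

end SoloBlind

end Summit.KontsevichZagierPeriods.KontsevichZagierPeriods.Theorems
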